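import Literature.AlgebraicGeometry.Motives.AbelianVarietyWeilPairingPullback
import Literature.AlgebraicGeometry.Motives.AbelianVarietyWeilPairingDivisorClass
import HarnessLib

/-!
# Functoriality of the level Weil pairing under an ARBITRARY homomorphism: `ē_N^{t^*Θ}(P, Q) = ē_N^Θ(t P, t Q)`
# (Mumford §20 (3) without dominance; `t^*Θ` the divisor-CLASS pullback)

Layer `Literature/AlgebraicGeometry/Motives`, namespace `Literature.AlgebraicGeometry.Motives.AbelianVariety`.
THEOREMS ONLY (no definition, no named fact, no instance, no `sorry`).

`Motives/AbelianVarietyWeilPairingPullback` proves `ē_N^{f^*Θ}(P, Q) = ē_N^Θ(f P, f Q)` for DOMINANT homomorphisms `f`, where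
`f^*Θ = Θ.pullback f` is the naive pullback of a Cartier divisor.  For an arbitrary homomorphism `t : A → B` of abelian
varieties (a closed immersion of an abelian subvariety, the pull-back `p^* : J_Y → J_X` of a cover of curves, …) the divisor
`Θ` can only be pulled back as a CLASS, `Θ.classPullback t = t^*(Θ.moveAway (t η_A))` (`Motives/CartierDivisorClassPullback`:
move `Θ` off the image of the generic point, then pull the local equations back through `t^♯_{η_A}`), and this file proves
Mumford's property (3) of `e_n` («if `f : X → Y` is a homomorphism, then `e_n(f(x), ŷ) = e_n(x, f̂(ŷ))`», read with
`φ_{f^*L} = f̂ ∘ φ_L ∘ f`) in that currency: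

* `IsTrivializer.pullbackAvoiding` — if `g` trivializes `[N]_B^* E` and `E` avoids `t(η_A)`, then `t^♯ g := RatFn.pullbackFn t g`
  trivializes `[N]_A^* (t^* E)` (`t` commutes with `[N]`; `[N]_B` and the translations fix `t(η_A)`);
* `kummerConst_pullbackAvoiding` — `e_N(P, t^*E) = e_N(t P, E)` (`t_P^♯ ∘ t^♯ = t^♯ ∘ t_{tP}^♯`, constants pull back to constants);
* `weilDiv_classPullback_sameDivisor` — `D_Q(t^*Θ) = t^*(D_{tQ}(Θ₁))`, `Θ₁ = Θ.moveAway (t η_A)`, as divisors;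
* **`weilPairingLevel_classPullback`** — `ē_N^{Θ.classPullback t}(P, Q) = ē_N^Θ(t P, t Q)` for all `P, Q ∈ A[N](K)`, any field,
  any homomorphism `t` (and `…_eq` with prescribed names for the images, `…_of_linEquiv_classPullback` for any divisor in the class).

## References
* [MumfordAV1970] D. Mumford, *Abelian Varieties* (1970), §20, property (3) of `e_n` (p. 186); §8 (`φ_{f^*L}`).
* [Lang1983AbelianVarieties] S. Lang, *Abelian Varieties*, Ch. VII §2, Prop. 2 (iii) and Thm. 5 (functoriality of `e_n(a, X)`).
* [GortzWedhorn2020] U. Görtz, T. Wedhorn, *Algebraic Geometry I*, 2nd ed. (2020), (11.16) and Def. 11.49 (pull-back of divisors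
  along non-dominant morphisms in the subgroup of divisors missing `f(η)`), Prop. 11.21 (`DivCl ≅ Pic`).
-/

universe u

open CategoryTheory CategoryTheory.Limits AlgebraicGeometry MonoidalCategory CartesianMonoidalCategory

noncomputable section

namespace Literature.AlgebraicGeometry.Motives

open scoped MonObj
open RatFn

namespace AbelianVariety

variable {K : Type u} [Field K] {A B : AbelianVariety K} (t : A ⟶ B)

/-! ### The image `t(η_A)` of the generic point is fixed by `[N]_B` and by the translations `t_{tP}` -/

/-- A translation fixes the generic point (it is an automorphism, in particular dominant). [folklore] -/
private theorem translation_apply_genericPoint (P : A.Points K) :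
    (A.translation P).left (genericPoint A.X.left) = genericPoint A.X.left :=
  genericPoint_eq_of_isDominant (A.translation P).left

/-- `[N]` fixes the generic point (it is dominant). [folklore] -/
private theorem zsmul_apply_genericPoint (n : ℤ) [IsDominant (Hom.toSchemeHom (n • 𝟙 A))] :
    Hom.toSchemeHom (n • 𝟙 A) (genericPoint A.X.left) = genericPoint A.X.left :=
  genericPoint_eq_of_isDominant (Hom.toSchemeHom (n • 𝟙 A))

/-- **`t_{tP}` fixes `t(η_A)`**: `t_{tP} (t η_A) = t (t_P η_A) = t η_A`. [cite: MumfordAV1970, §4 (Cor. 1 of the rigidity lemma)] -/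
theorem translation_map_apply_toSchemeHom_genericPoint (P : A.Points K) :
    (B.translation (AlgPoints.map t.hom.hom.hom P)).left (Hom.toSchemeHom t (genericPoint A.X.left)) =
      Hom.toSchemeHom t (genericPoint A.X.left) := by
  rw [← Scheme.Hom.comp_apply, ← translation_left_comp_toSchemeHom t P, Scheme.Hom.comp_apply,
    translation_apply_genericPoint]

/-- **`[N]_B` fixes `t(η_A)`**: `[N]_B (t η_A) = t ([N]_A η_A) = t η_A`. [cite: MumfordAV1970, §19 (first paragraph)] -/
theorem zsmul_apply_toSchemeHom_genericPoint (n : ℤ) [IsDominant (Hom.toSchemeHom (n • 𝟙 A))] :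
    Hom.toSchemeHom (n • 𝟙 B) (Hom.toSchemeHom t (genericPoint A.X.left)) = Hom.toSchemeHom t (genericPoint A.X.left) := by
  rw [← Scheme.Hom.comp_apply, toSchemeHom_comp_zsmul t n, Scheme.Hom.comp_apply, zsmul_apply_genericPoint]

/-! ### Rational functions: `t^♯` commutes with `[N]^♯`, with `t_P^♯`, and fixes constants -/

/-- **`[N]_A^♯ (t^♯ a) = t^♯ ([N]_B^♯ a)`** for `a` regular at `t(η_A)` (`t ≫ [N]_B = [N]_A ≫ t`). [cite: MumfordAV1970, §19 (first paragraph)] -/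
theorem functionFieldMap_zsmul_pullbackFn (n : ℤ) [IsDominant (Hom.toSchemeHom (n • 𝟙 A))]
    [IsDominant (Hom.toSchemeHom (n • 𝟙 B))] {a : B.X.left.functionField}
    (ha : IsRegularAt (Hom.toSchemeHom t (genericPoint A.X.left)) a) :
    functionFieldMap (Hom.toSchemeHom (n • 𝟙 A)) (pullbackFn (Hom.toSchemeHom t) a) =
      pullbackFn (Hom.toSchemeHom t) (functionFieldMap (Hom.toSchemeHom (n • 𝟙 B)) a) := by
  have h1 : IsRegularAt (Hom.toSchemeHom t (Hom.toSchemeHom (n • 𝟙 A) (genericPoint A.X.left))) a := by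
    rw [zsmul_apply_genericPoint]; exact ha
  have h2 : IsRegularAt (Hom.toSchemeHom (n • 𝟙 B) (Hom.toSchemeHom t (genericPoint A.X.left))) a := by
    rw [zsmul_apply_toSchemeHom_genericPoint]; exact ha
  rw [← pullbackFn_eq_functionFieldMap, ← pullbackFn_eq_functionFieldMap, ← pullbackFn_comp _ _ h1,
    ← pullbackFn_comp _ _ h2]
  exact congrArg (fun φ => pullbackFn φ a) (toSchemeHom_comp_zsmul t n).symm

/-- **`t_P^♯ (t^♯ a) = t^♯ (t_{tP}^♯ a)`** for `a` regular at `t(η_A)` (`t_P ≫ t = t ≫ t_{tP}`).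
[cite: MumfordAV1970, §4 (Cor. 1 of the rigidity lemma)] -/
theorem translFF_pullbackFn (P : A.Points K) {a : B.X.left.functionField}
    (ha : IsRegularAt (Hom.toSchemeHom t (genericPoint A.X.left)) a) :
    A.translFF P (pullbackFn (Hom.toSchemeHom t) a) =
      pullbackFn (Hom.toSchemeHom t) (B.translFF (AlgPoints.map t.hom.hom.hom P) a) := by
  have h1 : IsRegularAt (Hom.toSchemeHom t ((A.translation P).left (genericPoint A.X.left))) a := by
    rw [translation_apply_genericPoint]; exact ha
  have h2 : IsRegularAt ((B.translation (AlgPoints.map t.hom.hom.hom P)).left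
      (Hom.toSchemeHom t (genericPoint A.X.left))) a := by
    rw [translation_map_apply_toSchemeHom_genericPoint]; exact ha
  change functionFieldMap (A.translation P).left _ = pullbackFn _ (functionFieldMap _ a)
  rw [← pullbackFn_eq_functionFieldMap, ← pullbackFn_eq_functionFieldMap, ← pullbackFn_comp _ _ h1,
    ← pullbackFn_comp _ _ h2]
  exact congrArg (fun φ => pullbackFn φ a) (translation_left_comp_toSchemeHom t P)

/-- **`t^♯` fixes the constants**: `t^♯ c = c` for `c ∈ K` (`t` is a `K`-morphism). [folklore] -/
private theorem pullbackFn_toSchemeHom_algebraMap (c : K) :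
    pullbackFn (Hom.toSchemeHom t) (algebraMap K B.X.left.functionField c) = algebraMap K A.X.left.functionField c := by
  have eB : algebraMap K B.X.left.functionField c =
      toFunctionField (Hom.toSchemeHom t (genericPoint A.X.left))
        (algebraMap K (B.X.left.presheaf.stalk (Hom.toSchemeHom t (genericPoint A.X.left))) c) :=
    IsScalarTower.algebraMap_apply K _ _ c
  rw [eB, pullbackFn_toFunctionField, toFunctionField_genericPoint]
  change _ = algebraMap K (A.X.left.presheaf.stalk (genericPoint A.X.left)) c
  rw [algebraMap_stalk_apply, algebraMap_stalk_apply, Scheme.Hom.germ_stalkMap_apply]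
  have e : (Hom.toSchemeHom t).app ⊤ ((B.X.left ↘ Spec (.of K)).appTop ((Scheme.ΓSpecIso (.of K)).inv c)) =
      (A.X.left ↘ Spec (.of K)).appTop ((Scheme.ΓSpecIso (.of K)).inv c) := by
    change (Hom.toSchemeHom t).appTop _ = _
    rw [← CommRingCat.comp_apply, ← Scheme.Hom.comp_appTop,
      (Scheme.Hom.isOver_iff (Spec (.of K))).1 inferInstance]
  rw [e]
  rfl

/-! ### Transport of trivializers and of Kummer constants along `t` -/

variable {N : ℕ} [IsDominant (Hom.toSchemeHom ((N : ℤ) • 𝟙 A))] [IsDominant (Hom.toSchemeHom ((N : ℤ) • 𝟙 B))]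

/-- A trivializer `g` of `[N]^* E` is a UNIT at every point avoided by `E` and fixed by `[N]` — in particular at `t(η_A)` when
`E` avoids it. [folklore] -/
private theorem IsTrivializer.isUnitAt_of_avoids {E : CartierDivisor B.X.left} {g : B.X.left.functionField}
    (hg : B.IsTrivializer (n := N) E g) {x : B.X.left} (hE : E.Avoids x)
    (hx : Hom.toSchemeHom ((N : ℤ) • 𝟙 B) x = x) : IsUnitAt x g := by
  obtain ⟨i, hi⟩ := E.covers x
  have h1 : IsUnitAt x (functionFieldMap (Hom.toSchemeHom ((N : ℤ) • 𝟙 B)) (E.f i) * g) :=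
    hg.2 i x (by rw [hx]; exact hi)
  have h2 : IsUnitAt x (functionFieldMap (Hom.toSchemeHom ((N : ℤ) • 𝟙 B)) (E.f i)) := by
    have h := hE i hi
    rw [← hx] at h
    exact h.functionFieldMap
  have h3 := h2.inv.mul h1
  rwa [← mul_assoc, inv_mul_cancel₀ h2.ne_zero, one_mul] at h3

/-- **Transport of trivializers along an arbitrary homomorphism**: if `g` trivializes `[N]_B^* E` and `E` avoids `t(η_A)`, then
`t^♯ g` trivializes `[N]_A^*(t^* E)` (`t^* E = E.pullbackAvoiding t`).  [cite: Lang1983AbelianVarieties, Ch. VII §2 Prop. 3]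
[cite: MumfordAV1970, §20 (property (3) of e_n, p. 186)] -/
theorem IsTrivializer.pullbackAvoiding {E : CartierDivisor B.X.left} {g : B.X.left.functionField}
    (hg : B.IsTrivializer (n := N) E g) (hE : E.Avoids (Hom.toSchemeHom t (genericPoint A.X.left))) :
    A.IsTrivializer (n := N) (E.pullbackAvoiding (Hom.toSchemeHom t) hE) (pullbackFn (Hom.toSchemeHom t) g) := by
  have hgu : IsUnitAt (Hom.toSchemeHom t (genericPoint A.X.left)) g :=
    hg.isUnitAt_of_avoids hE (zsmul_apply_toSchemeHom_genericPoint t (N : ℤ))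
  refine ⟨pullbackFn_ne_zero _ hgu, fun i x hi => ?_⟩
  -- `[N]_B (t x) ∈ U_i`
  have hi' : Hom.toSchemeHom ((N : ℤ) • 𝟙 B) (Hom.toSchemeHom t x) ∈ E.U i.1 := by
    rw [← Scheme.Hom.comp_apply, toSchemeHom_comp_zsmul t (N : ℤ), Scheme.Hom.comp_apply]
    exact hi
  have hfi : IsUnitAt (Hom.toSchemeHom t (genericPoint A.X.left))
      (functionFieldMap (Hom.toSchemeHom ((N : ℤ) • 𝟙 B)) (E.f i.1)) := by
    have h : IsUnitAt (Hom.toSchemeHom ((N : ℤ) • 𝟙 B) (Hom.toSchemeHom t (genericPoint A.X.left))) (E.f i.1) := by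
      rw [zsmul_apply_toSchemeHom_genericPoint]
      exact hE i.1 i.2
    exact h.functionFieldMap
  rw [CartierDivisor.pullbackAvoiding_f, functionFieldMap_zsmul_pullbackFn t (N : ℤ) (hE i.1 i.2).isRegularAt,
    ← pullbackFn_mul _ hfi.isRegularAt hgu.isRegularAt]
  exact (hg.2 i.1 _ hi').pullbackFn

/-- **`e_N(P, t^*E) = e_N(t P, E)`** — the Kummer constant of the transported trivializer: `t_P^♯ t^♯ g / t^♯ g = t^♯(t_{tP}^♯ g / g)`
and `t^♯` fixes constants.  [cite: MumfordAV1970, §20 (property (3) of e_n, p. 186)] -/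
theorem kummerConst_pullbackAvoiding {E : CartierDivisor B.X.left} {g : B.X.left.functionField}
    (hg : B.IsTrivializer (n := N) E g) (hE : E.Avoids (Hom.toSchemeHom t (genericPoint A.X.left)))
    (P : A.torsionPoints K N) :
    kummerConst (hg.pullbackAvoiding t hE) P =
      kummerConst hg ⟨AlgPoints.map t.hom.hom.hom P.1, map_mem_torsionPoints t P.2⟩ := by
  have hgu : IsUnitAt (Hom.toSchemeHom t (genericPoint A.X.left)) g :=
    hg.isUnitAt_of_avoids hE (zsmul_apply_toSchemeHom_genericPoint t (N : ℤ))
  have hgu' : IsUnitAt (Hom.toSchemeHom t (genericPoint A.X.left)) (B.translFF (AlgPoints.map t.hom.hom.hom P.1) g) := by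
    have h := hgu
    rw [← translation_map_apply_toSchemeHom_genericPoint t P.1] at h
    exact h.functionFieldMap
  apply (algebraMap K A.X.left.functionField).injective
  rw [algebraMap_kummerConst, translFF_pullbackFn t P.1 hgu.isRegularAt,
    ← pullbackFn_div _ hgu'.isRegularAt hgu, ← pullbackFn_toSchemeHom_algebraMap t,
    algebraMap_kummerConst hg ⟨AlgPoints.map t.hom.hom.hom P.1, map_mem_torsionPoints t P.2⟩]

/-! ### `D_Q(t^*Θ) = t^*(D_{tQ}(Θ₁))` -/

/-- `pullbackAvoiding` along equal morphisms gives the same divisor. [folklore] -/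
private theorem pullbackAvoiding_congr_sameDivisor
    {X Y : Scheme.{u}} [IsIntegral X] [IsIntegral Y] {g₁ g₂ : Y ⟶ X} (h : g₁ = g₂) (D : CartierDivisor X)
    (h₁ : D.Avoids (g₁ (genericPoint Y))) (h₂ : D.Avoids (g₂ (genericPoint Y))) :
    (D.pullbackAvoiding g₁ h₁).SameDivisor (D.pullbackAvoiding g₂ h₂) := by
  subst h
  exact CartierDivisor.SameDivisor.refl _

/-- `t_R^* D` avoids `x` if `D` avoids `t_R x`. [folklore] -/
private theorem avoids_pullback_translation {D : CartierDivisor B.X.left} (R : B.Points K) {x : B.X.left}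
    (hD : D.Avoids ((B.translation R).left x)) : (D.pullback (B.translation R).left).Avoids x :=
  fun i hi => (hD i hi).functionFieldMap

/-- **`D_Q(t^*Θ) = t^*(D_{tQ}(Θ₁))` as divisors**, where `Θ₁ = Θ.moveAway (t η_A)` is the representative of the class of `Θ`
used by `classPullback` and `D_{tQ}(Θ₁) = t_{tQ}^*Θ₁ − Θ₁` avoids `t(η_A)`:
`t_Q^* t^* Θ₁ − t^*Θ₁ = (t_Q ≫ t)^*Θ₁ − t^*Θ₁ = (t ≫ t_{tQ})^*Θ₁ − t^*Θ₁ = t^*(t_{tQ}^*Θ₁ − Θ₁)`.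
[cite: MumfordAV1970, §8 (property (iv) of φ_L)] -/
theorem weilDiv_classPullback_sameDivisor (Θ : CartierDivisor B.X.left) (Q : A.Points K)
    (hE : (B.weilDiv (Θ.moveAway (Hom.toSchemeHom t (genericPoint A.X.left))) (AlgPoints.map t.hom.hom.hom Q)).Avoids
      (Hom.toSchemeHom t (genericPoint A.X.left))) :
    (A.weilDiv (Θ.classPullback (Hom.toSchemeHom t)) Q).SameDivisor
      ((B.weilDiv (Θ.moveAway (Hom.toSchemeHom t (genericPoint A.X.left))) (AlgPoints.map t.hom.hom.hom Q)).pullbackAvoiding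
        (Hom.toSchemeHom t) hE) := by
  set x₀ := Hom.toSchemeHom t (genericPoint A.X.left) with hx₀
  set Θ₁ := Θ.moveAway x₀ with hΘ₁
  have h₁ : Θ₁.Avoids x₀ := Θ.moveAway_avoids x₀
  -- `Θ₁` avoids `t (t_Q η_A)` and `t_{tQ} (t η_A)`
  have h₁Q : Θ₁.Avoids (Hom.toSchemeHom t ((A.translation Q).left (genericPoint A.X.left))) := by
    rw [translation_apply_genericPoint]; exact h₁
  have h₁tQ : Θ₁.Avoids ((B.translation (AlgPoints.map t.hom.hom.hom Q)).left x₀) := by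
    rw [hx₀, translation_map_apply_toSchemeHom_genericPoint]; exact h₁
  have hpb : (Θ₁.pullback (B.translation (AlgPoints.map t.hom.hom.hom Q)).left).Avoids x₀ :=
    avoids_pullback_translation (AlgPoints.map t.hom.hom.hom Q) h₁tQ
  -- the translated term
  have hT : ((Θ₁.pullbackAvoiding (Hom.toSchemeHom t) h₁).pullback (A.translation Q).left).SameDivisor
      ((Θ₁.pullback (B.translation (AlgPoints.map t.hom.hom.hom Q)).left).pullbackAvoiding (Hom.toSchemeHom t) hpb) := by
    refine (CartierDivisor.pullbackAvoiding_sameDivisor_pullback (A.translation Q).left _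
      (h₁Q.pullbackAvoiding _ _ h₁)).symm.trans ?_
    refine (CartierDivisor.pullbackAvoiding_comp_sameDivisor (Hom.toSchemeHom t) (A.translation Q).left h₁Q h₁).symm.trans ?_
    refine (pullbackAvoiding_congr_sameDivisor (translation_left_comp_toSchemeHom t Q) Θ₁ _
      (by rw [Scheme.Hom.comp_apply]; exact h₁tQ)).trans ?_
    refine (CartierDivisor.pullbackAvoiding_comp_sameDivisor (B.translation (AlgPoints.map t.hom.hom.hom Q)).left
      (Hom.toSchemeHom t) (by exact h₁tQ) (Θ₁.avoids_apply_genericPoint _)).trans ?_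
    exact (CartierDivisor.pullbackAvoiding_sameDivisor_pullback _ Θ₁ (Θ₁.avoids_apply_genericPoint _)).pullbackAvoiding
      (Hom.toSchemeHom t) _ hpb
  -- the negative term
  have hN : (-(Θ₁.pullbackAvoiding (Hom.toSchemeHom t) h₁)).SameDivisor ((-Θ₁).pullbackAvoiding (Hom.toSchemeHom t) h₁.neg) :=
    (CartierDivisor.pullbackAvoiding_neg_sameDivisor (Hom.toSchemeHom t) h₁).symm
  -- assemble
  change ((Θ₁.pullbackAvoiding (Hom.toSchemeHom t) h₁).pullback (A.translation Q).left +
    -(Θ₁.pullbackAvoiding (Hom.toSchemeHom t) h₁)).SameDivisor _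
  exact (hT.add hN).trans (CartierDivisor.pullbackAvoiding_add_sameDivisor (Hom.toSchemeHom t) hpb h₁.neg).symm

/-! ### `ē_N^{t^*Θ}(P, Q) = ē_N^Θ(t P, t Q)` for an arbitrary homomorphism `t` -/

/-- **Mumford §20 (3) for an ARBITRARY homomorphism** `t : A → B` of abelian varieties over a field `K`: for a Cartier divisor `Θ`
on `B`, `N`-torsion points `P, Q ∈ A[N](K)`, and `N`-torsion points `P', Q'` of `B` with `P' = t P`, `Q' = t Q`,
`ē_N^{t^*Θ}(P, Q) = ē_N^Θ(P', Q')`, where `t^*Θ = Θ.classPullback t` is the divisor-class pullback.  Proof: with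
`Θ₁ = Θ.moveAway (t η_A) ∼ Θ`, the trivializer `g` of `[N]^* D_{Q'}(Θ₁)` is a unit at `t(η_A)`, `t^♯ g` trivializes
`[N]^* D_Q(t^*Θ) = [N]^* t^* D_{Q'}(Θ₁)`, and `t_P^♯ t^♯ g / t^♯ g = t^♯(t_{P'}^♯ g / g) = ē^{Θ₁}(P', Q') = ē^Θ(P', Q')`.
[cite: MumfordAV1970, §20 (property (3) of e_n, p. 186)] [cite: Lang1983AbelianVarieties, Ch. VII §2 Prop. 2] -/
theorem weilPairingLevel_classPullback_eq (Θ : CartierDivisor B.X.left) (P Q : A.torsionPoints K N)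
    (P' Q' : B.torsionPoints K N) (hP : (P' : B.Points K) = AlgPoints.map t.hom.hom.hom P)
    (hQ : (Q' : B.Points K) = AlgPoints.map t.hom.hom.hom Q) :
    A.weilPairingLevel (Θ.classPullback (Hom.toSchemeHom t)) P Q = B.weilPairingLevel Θ P' Q' := by
  obtain ⟨P'₀, hP'₀⟩ := P'
  obtain ⟨Q'₀, hQ'₀⟩ := Q'
  subst hP hQ
  set x₀ := Hom.toSchemeHom t (genericPoint A.X.left) with hx₀
  have h₁ : (Θ.moveAway x₀).Avoids x₀ := Θ.moveAway_avoids x₀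
  -- `D_{tQ}(Θ₁)` avoids `x₀`
  have hE : (B.weilDiv (Θ.moveAway x₀) (AlgPoints.map t.hom.hom.hom Q.1)).Avoids x₀ := by
    refine CartierDivisor.Avoids.add (avoids_pullback_translation _ ?_) h₁.neg
    rw [hx₀, translation_map_apply_toSchemeHom_genericPoint]; exact h₁
  -- trivializer of `[N]_B^* D_{tQ}(Θ₁)` and its transport
  have hg : B.IsTrivializer (n := N) (B.weilDiv (Θ.moveAway x₀) (AlgPoints.map t.hom.hom.hom Q.1))
      (B.weilFn (Θ.moveAway x₀) ⟨AlgPoints.map t.hom.hom.hom Q.1, hQ'₀⟩) :=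
    B.isTrivializer_weilFn (Θ.moveAway x₀) ⟨AlgPoints.map t.hom.hom.hom Q.1, hQ'₀⟩
  have hg' := (hg.pullbackAvoiding t hE).of_sameDivisor (weilDiv_classPullback_sameDivisor t Θ Q.1 hE).symm
  rw [weilPairingLevel_eq_kummerConst (Q := Q) hg' P,
    weilPairingLevel_congr_linEquiv (Θ.moveAway_linEquiv x₀).symm,
    weilPairingLevel_eq_kummerConst (Q := ⟨AlgPoints.map t.hom.hom.hom Q.1, hQ'₀⟩) hg]
  exact kummerConst_pullbackAvoiding t hg hE P

/-- **`ē_N^{t^*Θ}(P, Q) = ē_N^Θ(t P, t Q)`** with the images as the `N`-torsion points `⟨P ≫ t, map_mem_torsionPoints⟩` of `B`,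
for an ARBITRARY homomorphism `t` and the class pullback `t^*Θ = Θ.classPullback t`.
[cite: MumfordAV1970, §20 (property (3) of e_n, p. 186)] -/
theorem weilPairingLevel_classPullback (Θ : CartierDivisor B.X.left) (P Q : A.torsionPoints K N) :
    A.weilPairingLevel (Θ.classPullback (Hom.toSchemeHom t)) P Q =
      B.weilPairingLevel Θ ⟨AlgPoints.map t.hom.hom.hom P.1, map_mem_torsionPoints t P.2⟩
        ⟨AlgPoints.map t.hom.hom.hom Q.1, map_mem_torsionPoints t Q.2⟩ :=
  weilPairingLevel_classPullback_eq t Θ P Q _ _ rfl rfl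

/-- The same for ANY divisor `Θ'` on `A` in the class `t^*[Θ]` (`Θ' ∼ Θ.classPullback t`, e.g. `Θ.pullbackAvoiding t h` for a
`Θ` missing `t(η_A)`, or `Θ.pullback t` when `t` is dominant): `ē_N^{Θ'}(P, Q) = ē_N^Θ(t P, t Q)`.
[cite: MumfordAV1970, §20 (property (3) of e_n, p. 186)] -/
theorem weilPairingLevel_of_linEquiv_classPullback {Θ' : CartierDivisor A.X.left} (Θ : CartierDivisor B.X.left)
    (hΘ : Θ'.LinEquiv (Θ.classPullback (Hom.toSchemeHom t))) (P Q : A.torsionPoints K N) :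
    A.weilPairingLevel Θ' P Q =
      B.weilPairingLevel Θ ⟨AlgPoints.map t.hom.hom.hom P.1, map_mem_torsionPoints t P.2⟩
        ⟨AlgPoints.map t.hom.hom.hom Q.1, map_mem_torsionPoints t Q.2⟩ := by
  rw [weilPairingLevel_congr_linEquiv hΘ, weilPairingLevel_classPullback]

end AbelianVariety

end Literature.AlgebraicGeometry.Motives

end
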